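import Mathlib

/-!
# `NewtonUnitEquationsNewtonTauWeakLevelVertsHalving` — THEOREM W♯: Gusfield halving, the glue inequality

Registered stub `stub_levelVertsHalving` of line `binomial-normal-form` (crux `NewtonTauWeak`,
stmt-ValiantsHypothesis-5904, lead c7): the halving inequality for hull-vertex counts of weighted level sets of
subset sums.

Setting.  Items `j : Fin (n₁ + n₂)` carry weights `g j ∈ [1, c]` and exponents `d j ∈ ℕ²`; the weight-`v` level
set is `LS v = {Σ_{j ∈ J} d j : Σ_{j ∈ J} g j = v} ⊆ ℕ²` and `LV v` is the number of extreme points of the convex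
hull of its image in `ℝ²`.  Splitting the items into the first `n₁` (via `Fin.castAdd n₂`) and the last `n₂`
(via `Fin.natAdd n₁`) gives block level sets `LS₁ v₁`, `LS₂ v₂` with vertex counts `LV₁ v₁`, `LV₂ v₂`.

Claim.  Given, as hypotheses,
* `hM` (Minkowski): `#vert (P ⊕ Q) ≤ 2 (#vert P + #vert Q)` for the sumset `P ⊕ Q = (P ×ˢ Q).image (·.1 + ·.2)`,
* `hU` (union): `#vert (⋃_{i ∈ s} S i) ≤ Σ_{i ∈ s} #vert (S i)`,
* `hS` (split): `LS v = ⋃_{v₁ ≤ v} LS₁ v₁ ⊕ LS₂ (v - v₁)`,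
one has `LV v ≤ Σ_{v₁ ≤ c n₁} 2 (LV₁ v₁ + LV₂ (v - v₁))`.

Proof sketch.  Rewrite the level set with `hS`, bound the union by `hU`, and bound each piece: for `v₁ ≤ c n₁`
by `hM`; for `v₁ > c n₁` the block-1 level set `LS₁ v₁` is empty (a subset of `Fin n₁` weighs at most `c n₁`,
`LevelVertsHalvingAux.filter_weight_eq_empty`), so the piece is the empty sumset and contributes `0`.  The
surviving index set is enlarged to `range (c n₁ + 1)` (`LevelVertsHalvingAux.sum_le_sum_of_vanish`).
Everything is `ℕ`-valued bookkeeping. [folklore: Gusfield halving]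
-/

-- Sub = Summit single-conjunct layout: the duplicated namespace component is mandated by the tree.
set_option linter.dupNamespace false

noncomputable section

open scoped BigOperators

namespace Summit.ValiantsHypothesis.ValiantsHypothesis.Theorems.NewtonUnitEquationsNewtonTauWeak

namespace LevelVertsHalvingAux

/-- **Summation glue.**  If `f` vanishes off `t` and is dominated by `T` on `t`, then every partial sum of `f`
is at most the sum of `T` over `t`. [folklore] -/
theorem sum_le_sum_of_vanish (s t : Finset ℕ) (f T : ℕ → ℕ) (hle : ∀ i ∈ t, f i ≤ T i)
    (hz : ∀ i, i ∉ t → f i = 0) : ∑ i ∈ s, f i ≤ ∑ i ∈ t, T i := by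
  calc ∑ i ∈ s, f i = ∑ i ∈ s ∩ t, f i :=
        (Finset.sum_subset Finset.inter_subset_left fun i hi hit =>
          hz i fun h => hit (Finset.mem_inter.mpr ⟨hi, h⟩)).symm
    _ ≤ ∑ i ∈ s ∩ t, T i := Finset.sum_le_sum fun i hi => hle i (Finset.mem_inter.mp hi).2
    _ ≤ ∑ i ∈ t, T i := Finset.sum_le_sum_of_subset Finset.inter_subset_right

/-- **Block-1 level sets above the total weight are empty.**  If every weight is at most `c`, then no subset of
the first block `Fin n₁` has weight `v₁ > c * n₁`. [folklore] -/
theorem filter_weight_eq_empty (n₁ n₂ c v₁ : ℕ) (g : Fin (n₁ + n₂) → ℕ) (hg : ∀ j, 1 ≤ g j ∧ g j ≤ c)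
    (hv₁ : c * n₁ < v₁) :
    (Finset.univ.filter fun J : Finset (Fin n₁) => ∑ j ∈ J, g (Fin.castAdd n₂ j) = v₁) = ∅ := by
  refine Finset.filter_eq_empty_iff.mpr ?_
  intro J _ hJ
  refine absurd hv₁ (not_lt.mpr ?_)
  rw [← hJ]
  calc ∑ j ∈ J, g (Fin.castAdd n₂ j) ≤ ∑ j, g (Fin.castAdd n₂ j) :=
        Finset.sum_le_univ_sum_of_nonneg fun _ => Nat.zero_le _
    _ ≤ ∑ _j : Fin n₁, c := Finset.sum_le_sum fun j _ => (hg _).2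
    _ = c * n₁ := by simp [mul_comm]

end LevelVertsHalvingAux

/-- **THEOREM W♯, Gusfield halving (glue).**  For items `j : Fin (n₁ + n₂)` with weights `g j ∈ [1, c]` and
exponents `d j ∈ ℕ²`, the number of hull vertices of the weight-`v` level set of subset sums is at most
`Σ_{v₁ ≤ c n₁} 2 (LV₁ v₁ + LV₂ (v - v₁))`, the block vertex counts of the first `n₁` and the last `n₂` items —
given the Minkowski bound `hM`, the union bound `hU` and the split identity `hS` as hypotheses.  Pieces with
`v₁ > c n₁` vanish because a subset of `Fin n₁` weighs at most `c n₁`. [folklore: Gusfield halving] -/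
theorem stub_levelVertsHalving (n₁ n₂ c v : ℕ) (g : Fin (n₁ + n₂) → ℕ) (hg : ∀ j, 1 ≤ g j ∧ g j ≤ c)
    (d : Fin (n₁ + n₂) → (Fin 2 →₀ ℕ))
    (hM : ∀ P Q : Finset (Fin 2 →₀ ℕ),
      (Set.extremePoints ℝ (convexHull ℝ ((fun e : Fin 2 →₀ ℕ => fun i : Fin 2 => ((e i : ℕ) : ℝ)) ''
        (((P ×ˢ Q).image (fun pq : (Fin 2 →₀ ℕ) × (Fin 2 →₀ ℕ) => pq.1 + pq.2) : Finset (Fin 2 →₀ ℕ)) :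
          Set (Fin 2 →₀ ℕ))))).ncard ≤
        2 * ((Set.extremePoints ℝ (convexHull ℝ ((fun e : Fin 2 →₀ ℕ => fun i : Fin 2 => ((e i : ℕ) : ℝ)) ''
            (P : Set (Fin 2 →₀ ℕ))))).ncard +
          (Set.extremePoints ℝ (convexHull ℝ ((fun e : Fin 2 →₀ ℕ => fun i : Fin 2 => ((e i : ℕ) : ℝ)) ''
            (Q : Set (Fin 2 →₀ ℕ))))).ncard))
    (hU : ∀ (s : Finset ℕ) (S : ℕ → Finset (Fin 2 →₀ ℕ)),
      (Set.extremePoints ℝ (convexHull ℝ ((fun e : Fin 2 →₀ ℕ => fun i : Fin 2 => ((e i : ℕ) : ℝ)) ''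
        ((s.biUnion S : Finset (Fin 2 →₀ ℕ)) : Set (Fin 2 →₀ ℕ))))).ncard ≤
        ∑ i ∈ s, (Set.extremePoints ℝ (convexHull ℝ ((fun e : Fin 2 →₀ ℕ => fun i : Fin 2 => ((e i : ℕ) : ℝ)) ''
          (S i : Set (Fin 2 →₀ ℕ))))).ncard)
    (hS : ∀ (n₁ n₂ v : ℕ) (g : Fin (n₁ + n₂) → ℕ) (d : Fin (n₁ + n₂) → (Fin 2 →₀ ℕ)),
      ((Finset.univ.filter fun J : Finset (Fin (n₁ + n₂)) => ∑ j ∈ J, g j = v).image fun J => ∑ j ∈ J, d j) =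
        (Finset.range (v + 1)).biUnion fun v₁ =>
          ((((Finset.univ.filter fun J : Finset (Fin n₁) => ∑ j ∈ J, g (Fin.castAdd n₂ j) = v₁).image
              fun J => ∑ j ∈ J, d (Fin.castAdd n₂ j)) ×ˢ
            ((Finset.univ.filter fun J : Finset (Fin n₂) => ∑ j ∈ J, g (Fin.natAdd n₁ j) = v - v₁).image
              fun J => ∑ j ∈ J, d (Fin.natAdd n₁ j))).image
            fun pq : (Fin 2 →₀ ℕ) × (Fin 2 →₀ ℕ) => pq.1 + pq.2)) :
    (Set.extremePoints ℝ (convexHull ℝ ((fun e : Fin 2 →₀ ℕ => fun i : Fin 2 => ((e i : ℕ) : ℝ)) ''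
      (((Finset.univ.filter fun J : Finset (Fin (n₁ + n₂)) => ∑ j ∈ J, g j = v).image
        fun J => ∑ j ∈ J, d j : Finset (Fin 2 →₀ ℕ)) : Set (Fin 2 →₀ ℕ))))).ncard ≤
      ∑ v₁ ∈ Finset.range (c * n₁ + 1), 2 *
        ((Set.extremePoints ℝ (convexHull ℝ ((fun e : Fin 2 →₀ ℕ => fun i : Fin 2 => ((e i : ℕ) : ℝ)) ''
          (((Finset.univ.filter fun J : Finset (Fin n₁) => ∑ j ∈ J, g (Fin.castAdd n₂ j) = v₁).image
            fun J => ∑ j ∈ J, d (Fin.castAdd n₂ j) : Finset (Fin 2 →₀ ℕ)) : Set (Fin 2 →₀ ℕ))))).ncard +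
        (Set.extremePoints ℝ (convexHull ℝ ((fun e : Fin 2 →₀ ℕ => fun i : Fin 2 => ((e i : ℕ) : ℝ)) ''
          (((Finset.univ.filter fun J : Finset (Fin n₂) => ∑ j ∈ J, g (Fin.natAdd n₁ j) = v - v₁).image
            fun J => ∑ j ∈ J, d (Fin.natAdd n₁ j) : Finset (Fin 2 →₀ ℕ)) : Set (Fin 2 →₀ ℕ))))).ncard) := by
  rw [hS n₁ n₂ v g d]
  refine le_trans (hU _ _) ?_
  refine LevelVertsHalvingAux.sum_le_sum_of_vanish _ _ _ _ (fun v₁ _ => hM _ _) fun v₁ hv₁ => ?_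
  have hlt : c * n₁ < v₁ := by
    rw [Finset.mem_range, not_lt] at hv₁
    exact hv₁
  have hP : (Finset.univ.filter fun J : Finset (Fin n₁) => ∑ j ∈ J, g (Fin.castAdd n₂ j) = v₁) = ∅ :=
    LevelVertsHalvingAux.filter_weight_eq_empty n₁ n₂ c v₁ g hg hlt
  rw [hP]
  simp

end Summit.ValiantsHypothesis.ValiantsHypothesis.Theorems.NewtonUnitEquationsNewtonTauWeak

end
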